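import Summits.BirchSwinnertonDyer.Rank1Residual.X11b.BDPRouteOddOnTree
import HarnessLib

/-!
# Class X11b at every odd prime: the PER-DATUM entry point — the Heegner field `K` and the datum
# `(Dt, H, ι, P, Wd, Cd)` EXPOSED as binders, the open input restricted to THAT datum (cell
# `b2b-bsdres`, team `x11b3` = N8/O2, S25)

HONEST FRAMING (verbatim, cell `b2b-bsdres`, run/shared/lean/b2b/bsd-rank1-residual/): the goal of
the cell is to DELETE the COMBINATION-SHAPED residual classes for ALL analytic-rank `≤ 1` curves
over `ℚ` — "full BSD formula for every rank `≤ 1` curve in class `C`" assembled STRICTLY from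
published theorems — so that the rank-`≤ 1` remainder becomes exactly the CONSTRUCTION-SHAPED
classes, which are TYPED (missing-input Props), NOT attempted; this is not "finishing BSD".
Team N8/O2 = `x11b3`, seat `b2b-bsdres-x11b3-p2` (GEN 3), LEAD DEAL #7 R7-64 (α) / R7-65 (S25,
x11b3-r2's proposal). THEOREMS ONLY (no definition, no named fact, no `sorry`); nothing booked;
labels UNCHANGED (X11 ∧ `r = 1` at `p = 3` stays CONSTRUCTION-SHAPED); O2 OPEN / N8 CONSTRUCTION.
The multr1-p2 lineage files (`BDPRouteOddOnTree`, `BDPRouteSurjOdd`, `BDPRouteOddPrime[Class]`,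
gen 18) are CITED BY NAME and untouched.

## What and why

`missingLowerBoundAt_of_classX11b_of_surj_of_openInput_odd` / `bsdp_of_classX11b_odd_of_onTreeInputs`
(`BDPRouteOddOnTree` §3) OBTAIN the Heegner field and datum `(K, Dt, H, ι, P, Wd, Cd)` from
Hoffstein–Luo (`exists_oddHeegnerData hnf hHL hMaz hNS …`) and demand THE open input at every
admissible datum. This file is the same proof with the `obtain` replaced by BINDERS — so that a
K-dependent input (LEAD R7-64: L59 case (A) `k(K,3) = 0`, S24-b's `k`-split, a future per-`K` H1)
becomes SELECTABLE per pair `E`: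

* `missingLowerBoundAt_of_datum_of_openInputAt_datum_odd` — the main-conjecture half
  `Typed.MissingLowerBoundAt W p` at ONE X11b pair with `ρ̄_{E,p}` onto, from a GIVEN odd-`d_K`
  Manin-good Heegner datum (binders = exactly the `∃`-body of `exists_oddHeegnerData`:
  `IsImaginaryQuadratic K`, `Odd d_K`, `p ∤ d_K`, Heegner hypothesis for `N_E`,
  `P ↦ heegnerPointComplex Dt H`, `p ∤ Dt.c`, `p ∤ w_K`, `L(E^{d_K},1) ≠ 0`, the global minimal twist
  model `Cd • E^{d_K} = Wd`) and THE open input `hA` AT THIS DATUM ONLY (`∀ κ γ 𝔭` as today).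
  `hnf`, `hHL`, `hMaz`, `hNS` are NOT binders: Hoffstein–Luo / Mazur / the newform only PRODUCE a datum.
* `bsdp_of_classX11b_odd_of_datum` — `BSDp W p` at the pair from the same datum: the lower half as
  above (open input guarded by `Surj W p`, the branch where it is used), the Euler-system half ON
  the atom `(ram) ∧ p ∤ ∏c` AT THE SAME DATUM (`halves_of_heegnerData_of_odd … .2` with Kolyvagin's
  Thm. A `hB`) — so Hoffstein–Luo is not needed there either — and the typed inputs (T2′) off the
  atom / (T4″) at the non-surjective corner exactly as in `bsdp_of_classX11b_odd_of_onTreeInputs`.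
* an `example` re-deriving the class-level `bsdp_of_classX11b_odd_of_onTreeInputs` statement from
  `bsdp_of_classX11b_odd_of_datum` + `exists_oddHeegnerData` (nothing was lost).

HONEST: this proves the SAME conditional `BSDp` with one quantifier moved; by itself it books
nothing; a per-pair search 'Heegner(N_E) ∧ L(E^d,1) ≠ 0 ∧ 3 ∤ h(d)' would be instrument-tier
EVIDENCE and is NOT commissioned (R7-64/R7-65).

References: [Castella2018] Thm. 2.3 (p. 5), Thm. 3.2 (p. 9); [Castella2018Erratum] (2.4);
[JetchevSkinnerWan2017] §7.4.1–7.4.2 (pp. 30–31); [Skinner2016PacificMC] Thm. C, footnote 1;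
[Wuthrich2014] Prop. 21; [Kolyvagin1990] Thm. A; [McCallumLMS1991] §1 Theorem; [HoffsteinLuo1997];
[Mazur1978] Cor. 4.1; [MilneADT2006] I 2.8, 4.10(b); [Miller2011LMS] Def. 1.1.
-/

noncomputable section

open scoped Classical

open WeierstrassCurve NumberField IsDedekindDomain Field
open Literature.NumberTheory.EllipticCurves Literature.NumberTheory.EllipticCurves.GreenbergSelmer
  Literature.NumberTheory.EllipticCurves.ModularForms
  Literature.NumberTheory.EllipticCurves.Rank1Residual
  Literature.NumberTheory.EllipticCurves.Rank1Residual.Typed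
  Literature.NumberTheory.EllipticCurves.Wuthrich2014
  Literature.NumberTheory.EllipticCurves.BalakrishnanEtAl2019
  Literature.NumberTheory.QuadraticFields.Quadratic
  Literature.NumberTheory.Automorphic
  Literature.NumberTheory.GaloisRepresentations Literature.NumberTheory.GaloisCohomology
  Summit.BirchSwinnertonDyer.Rank1Residual.X11b.AcSelmer
  Summit.BirchSwinnertonDyer.Rank1Residual.X11b.LocBridge

namespace Summit.BirchSwinnertonDyer.Rank1Residual.X11b

section Datum

variable (W : WeierstrassCurve ℚ) [W.IsElliptic] [W.IsGloballyMinimal] (p : ℕ) [Fact p.Prime]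
  [NeZero (W.conductorNorm ℤ)] (K : Type) [Field K] [NumberField K]
  (Dt : ModularParametrizationData W (W.conductorNorm ℤ))
  (H : HeegnerDatum (W.conductorNorm ℤ) (NumberField.discr K)) (ι : K →+* ℂ)
  (P : (W.baseChange K).toAffine.Point)

/-- **The main-conjecture half `ord_p #Ш(E)_an ≤ ord_p #Ш(E)` at ONE X11b pair, ANY ODD `p`,
`ρ̄_{E,p}` onto, FROM A GIVEN HEEGNER DATUM and THE open input AT THAT DATUM.** Binders: the pair
(`r_an = 1`, `p ≠ 2`, multiplicative at `p`, `E[p]` irreducible, `ρ̄_{E,p}` onto); the Heegner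
field and datum `(K, Dt, H, ι, P, Wd, Cd)` with EXACTLY the admissibility clauses
`exists_oddHeegnerData` delivers (`K` imaginary quadratic, `d_K` odd, `p ∤ d_K`, Heegner hypothesis
for `N_E`, `P ↦ heegnerPointComplex Dt H`, `p ∤ Dt.c` (Manin-good), `p ∤ w_K`, `L(E^{d_K},1) ≠ 0`,
`Cd • E^{d_K} = Wd` globally minimal); the published inputs Gross–Zagier (at `K`), Kolyvagin,
Wuthrich 2014 Prop. 21, GZK, modularity, Poitou–Tate, local Euler characteristic; and `hA` = THE
open input `(IMC≥∘BDP)ᵗ` at every anticyclotomic `κ`, generator `γ`, degree-one `𝔭 ∋ p` — AT THIS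
DATUM ONLY. Hoffstein–Luo, Mazur 1978 Cor. 4.1, the newform and Néron scaling are NOT binders (they
only produce a datum in `missingLowerBoundAt_of_classX11b_of_surj_of_openInput_odd`). Proof:
`indexLowerBoundAt_of_heegner_of_openInput_prime` (STEP L at the datum) then
`missingLowerBoundAt_of_indexLowerBoundAt_of_surj_odd`. CONDITIONAL on the open input; nothing
booked. [cite: Wuthrich2014, Prop. 21 (p. 400)] [cite: JetchevSkinnerWan2017, §7.4.1 (pp. 30–31)]
[cite: Castella2018, Thm. 2.3 (p. 5), Thm. 3.2 (p. 9)] [cite: Miller2011LMS, Def. 1.1] -/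
theorem missingLowerBoundAt_of_datum_of_openInputAt_datum_odd
    (hGZ : gross_zagier (W.conductorNorm ℤ) W K)
    (hKo : ∀ (N : ℕ) [NeZero N] (W : WeierstrassCurve ℚ) (K : Type) [Field K] [NumberField K],
      kolyvagin N W K)
    (hWu : sha_dvd_analyticSha)
    (hGZK : rank_eq_analyticRank_of_analyticRank_le_one) (hmod : hasEntireLFunction_rat)
    (hPT : ∀ (K : Type) [Field K] [NumberField K], poitouTate_sum_localTatePairing_eq_zero K)
    (hEP : ∀ (K : Type) [Field K] [NumberField K] (v : HeightOneSpectrum (𝓞 K)),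
      localEulerPoincareCharacteristic (v.adicCompletion K))
    -- the pair
    (hr : W.analyticRank = 1) (hp2 : p ≠ 2) (hmult : Mult W p) (hirr : Irr W p) (hsurj : Surj W p)
    -- the Heegner field and datum (the `∃`-body of `exists_oddHeegnerData`, as binders)
    (hK : IsImaginaryQuadratic K) (hodd : Odd (NumberField.discr K))
    (hpd : ¬ (p : ℤ) ∣ NumberField.discr K)
    (hHN : SatisfiesHeegnerHypothesis (W.conductorNorm ℤ) K)
    (hP : WeierstrassCurve.Affine.Point.map ι.toRatAlgHom P = heegnerPointComplex Dt H)
    (hc : ¬ (p : ℤ) ∣ Dt.c) (hμ : ¬ p ∣ Units.torsionOrder K)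
    (hLt : (W.quadraticTwist (NumberField.discr K : ℚ)).entireLFunction 1 ≠ 0)
    (Wd : WeierstrassCurve ℚ) [Wd.IsElliptic] [Wd.IsGloballyMinimal] (Cd : VariableChange ℚ)
    (hWd : Cd • W.quadraticTwist (NumberField.discr K : ℚ) = Wd)
    -- THE open input AT THIS DATUM only
    (hA : ∀ (κ : ZpExtension K p), κ.IsAnticyclotomic →
      ∀ (γ : Field.absoluteGaloisGroup K) [Fact (κ.IsTopGenerator γ)] (𝔭 : HeightOneSpectrum (𝓞 K))
        (h𝔭 : ((p : ℕ) : 𝓞 K) ∈ 𝔭.asIdeal) (he : 𝔭.asIdeal.ramificationIdx (𝓞 ℚ) = 1)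
        (hf : 𝔭.asIdeal.inertiaDeg (𝓞 ℚ) = 1),
        IMCLowerWaldspurgerOnTreeAt p κ 𝔭 γ (embAt K p 𝔭 h𝔭 he hf) P) :
    Typed.MissingLowerBoundAt W p :=
  missingLowerBoundAt_of_indexLowerBoundAt_of_surj_odd W p K Dt H ι P hGZ (hKo _ W K) hWu hGZK hmod
    hr hp2 hmult hsurj hK hodd hpd hHN hP hc hμ hLt Wd Cd hWd
    (indexLowerBoundAt_of_heegner_of_openInput_prime W p _ K Dt H ι P hGZ hKo hmod hPT hEP hr hmult
      hirr rfl hK hHN hLt hP hA)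

/-- **`BSD(E, p)` at ONE X11b pair, ANY ODD `p`, FROM A GIVEN HEEGNER DATUM** (x11b3-r2's
`bsdp_of_imcLowerWaldspurger_at_datum`). Same datum binders as
`missingLowerBoundAt_of_datum_of_openInputAt_datum_odd`; published inputs Gross–Zagier (at `K`),
Kolyvagin (+ Thm. A `hB`), Skinner 2016 Thm. C, Wuthrich 2014 Prop. 21, GZK, modularity,
Poitou–Tate, local Euler characteristic; the open input `hA` AT THIS DATUM, guarded by `Surj W p`
(the branch in which it is used); the typed inputs (T2′) `hU` (Euler-system half OFF the atom
`(ram) ∧ p ∤ ∏c`) and (T4″) `hC` (non-surjective corner) VERBATIM as in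
`bsdp_of_classX11b_odd_of_onTreeInputs`. **Hoffstein–Luo, Mazur Cor. 4.1 and the newform are NOT
binders**: per datum the Euler-system half on the atom is taken AT THE SAME DATUM
(`halves_of_heegnerData_of_odd … .2` + Kolyvagin Thm. A), not through
`missingUpperBoundAt_of_classX11b_of_ram_of_not_dvd` (which re-chooses a datum). Proves the same
conditional `BSDp` as the class-level theorem with the quantifier over the datum moved outside;
nothing booked; labels unchanged. [cite: JetchevSkinnerWan2017, §7.4.1–7.4.2 (pp. 30–31)]
[cite: Castella2018, Thm. 2.3 (p. 5), Thm. 3.2 (p. 9)] [cite: Skinner2016PacificMC, Thm. C (§1) and footnote 1]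
[cite: McCallumLMS1991, §1 Theorem (Kolyvagin), p. 296] [cite: Wuthrich2014, Prop. 21 (p. 400)]
[cite: MilneADT2006, Ch. I, Thm. 4.10(b) and Thm. 2.8] [cite: Miller2011LMS, Def. 1.1] -/
theorem bsdp_of_classX11b_odd_of_datum
    -- published inputs (named facts of the tree)
    (hGZ : gross_zagier (W.conductorNorm ℤ) W K)
    (hKo : ∀ (N : ℕ) [NeZero N] (W : WeierstrassCurve ℚ) (K : Type) [Field K] [NumberField K],
      kolyvagin N W K)
    (hB : Kolyvagin1990_padicValNat_card_sha_le (W.conductorNorm ℤ) W K)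
    (hSk : Skinner2016.thmC_padicValRat_bsd_rank_zero) (hWu : sha_dvd_analyticSha)
    (hGZK : rank_eq_analyticRank_of_analyticRank_le_one) (hmod : hasEntireLFunction_rat)
    (hPT : ∀ (K : Type) [Field K] [NumberField K], poitouTate_sum_localTatePairing_eq_zero K)
    (hEP : ∀ (K : Type) [Field K] [NumberField K] (v : HeightOneSpectrum (𝓞 K)),
      localEulerPoincareCharacteristic (v.adicCompletion K))
    -- the pair
    (hX : ClassX11b W p)
    -- the Heegner field and datum (the `∃`-body of `exists_oddHeegnerData`, as binders)
    (hK : IsImaginaryQuadratic K) (hodd : Odd (NumberField.discr K))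
    (hpd : ¬ (p : ℤ) ∣ NumberField.discr K)
    (hHN : SatisfiesHeegnerHypothesis (W.conductorNorm ℤ) K)
    (hP : WeierstrassCurve.Affine.Point.map ι.toRatAlgHom P = heegnerPointComplex Dt H)
    (hc : ¬ (p : ℤ) ∣ Dt.c) (hμ : ¬ p ∣ Units.torsionOrder K)
    (hLt : (W.quadraticTwist (NumberField.discr K : ℚ)).entireLFunction 1 ≠ 0)
    (Wd : WeierstrassCurve ℚ) [Wd.IsElliptic] [Wd.IsGloballyMinimal] (Cd : VariableChange ℚ)
    (hWd : Cd • W.quadraticTwist (NumberField.discr K : ℚ) = Wd)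
    -- THE open input AT THIS DATUM only (used on the surjective branch)
    (hA : Surj W p → ∀ (κ : ZpExtension K p), κ.IsAnticyclotomic →
      ∀ (γ : Field.absoluteGaloisGroup K) [Fact (κ.IsTopGenerator γ)] (𝔭 : HeightOneSpectrum (𝓞 K))
        (h𝔭 : ((p : ℕ) : 𝓞 K) ∈ 𝔭.asIdeal) (he : 𝔭.asIdeal.ramificationIdx (𝓞 ℚ) = 1)
        (hf : 𝔭.asIdeal.inertiaDeg (𝓞 ℚ) = 1),
        IMCLowerWaldspurgerOnTreeAt p κ 𝔭 γ (embAt K p 𝔭 h𝔭 he hf) P)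
    -- (T2′) the Euler-system half off the unconditional atom (ram) ∧ `p ∤ ∏ c_ℓ`
    (hU : Surj W p → ¬ (Ram W p ∧ ¬ p ∣ W.tamagawaProduct) → Typed.MissingUpperBoundAt W p)
    -- (T4″) the non-surjective corner, localised: `p ∣ ord_p Δ_min`, no (ram) prime
    (hC : ¬ Surj W p → p ∣ padicValInt p W.minimalDiscriminantInt → ¬ Ram W p →
      Typed.MissingPPartAt W p) :
    BSDp W p := by
  have hp : p.Prime := Fact.out
  obtain ⟨hr, hp2, hmult, hirr⟩ := hX
  refine Typed.bsdp_of_missingPPartAt W p hGZK (by rw [hr]) ?_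
  by_cases hs : Surj W p
  · refine Typed.missingPPartAt_of_lower_of_upper W p
      (missingLowerBoundAt_of_datum_of_openInputAt_datum_odd W p K Dt H ι P hGZ hKo hWu hGZK hmod
        hPT hEP hr hp2 hmult hirr hs hK hodd hpd hHN hP hc hμ hLt Wd Cd hWd (hA hs)) ?_
    by_cases hloc : Ram W p ∧ ¬ p ∣ W.tamagawaProduct
    · -- the Euler-system half AT THE SAME DATUM (Kolyvagin Thm. A; no Hoffstein–Luo)
      exact (halves_of_heegnerData_of_odd W p K Dt H ι P hGZ (hKo _ W K) hSk hGZK hmod hr hp2 hmult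
        hirr hloc.1 hK hodd hpd hHN hP hc hμ hLt Wd Cd hWd).2 hloc.2
        (fun _ hnt ↦ hB hK hHN ⟨Dt, H, ι, hP⟩ hnt hp hp2 hs)
    · exact hU hs hloc
  · obtain ⟨hdvd, hnr⟩ := ClassX11b.dvd_and_not_ram_of_not_surj W p ⟨hr, hp2, hmult, hirr⟩ hs
    exact hC hs hdvd hnr

end Datum

/-! ### Check: the class-level statement re-derived from the per-datum entry point -/

/-- Nothing was lost: `bsdp_of_classX11b_odd_of_onTreeInputs` (statement verbatim) follows from
`bsdp_of_classX11b_odd_of_datum` and Hoffstein–Luo's datum `exists_oddHeegnerData` — an `example`,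
not a new declaration. [folklore] -/
example
    (hGZ : ∀ (N : ℕ) [NeZero N] (W : WeierstrassCurve ℚ) (K : Type) [Field K] [NumberField K],
      gross_zagier N W K)
    (hKo : ∀ (N : ℕ) [NeZero N] (W : WeierstrassCurve ℚ) (K : Type) [Field K] [NumberField K],
      kolyvagin N W K)
    (hB : ∀ (N : ℕ) [NeZero N] (W : WeierstrassCurve ℚ) (K : Type) [Field K] [NumberField K],
      Kolyvagin1990_padicValNat_card_sha_le N W K)
    (hSk : Skinner2016.thmC_padicValRat_bsd_rank_zero) (hWu : sha_dvd_analyticSha)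
    (hGZK : rank_eq_analyticRank_of_analyticRank_le_one) (hmod : hasEntireLFunction_rat)
    (hnf : exists_isNewformOf) (hHL : HoffsteinLuo1997_exists_twist_L_one_ne_zero)
    (hMaz : mazur_not_dvd_maninConstant_of_odd)
    (hPT : ∀ (K : Type) [Field K] [NumberField K], poitouTate_sum_localTatePairing_eq_zero K)
    (hEP : ∀ (K : Type) [Field K] [NumberField K] (v : HeightOneSpectrum (𝓞 K)),
      localEulerPoincareCharacteristic (v.adicCompletion K))
    (hA : ∀ (W : WeierstrassCurve ℚ) [W.IsElliptic] [W.IsGloballyMinimal] (p : ℕ) [Fact p.Prime]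
      (N : ℕ) [NeZero N] (K : Type) [Field K] [NumberField K]
      (Dt : ModularParametrizationData W N) (H : HeegnerDatum N (NumberField.discr K)) (ι : K →+* ℂ)
      (P : (W.baseChange K).toAffine.Point),
      ClassX11b W p → Surj W p → W.conductorNorm ℤ = N → IsImaginaryQuadratic K →
      Odd (NumberField.discr K) → ¬ (p : ℤ) ∣ NumberField.discr K → ¬ p ∣ Units.torsionOrder K →
      SatisfiesHeegnerHypothesis N K →
      (W.quadraticTwist (NumberField.discr K : ℚ)).entireLFunction 1 ≠ 0 →
      WeierstrassCurve.Affine.Point.map ι.toRatAlgHom P = heegnerPointComplex Dt H →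
      ¬ (p : ℤ) ∣ Dt.c → ¬ IsOfFinAddOrder P →
      ∀ (κ : ZpExtension K p), κ.IsAnticyclotomic →
        ∀ (γ : Field.absoluteGaloisGroup K) [Fact (κ.IsTopGenerator γ)]
          (𝔭 : HeightOneSpectrum (𝓞 K)) (h𝔭 : ((p : ℕ) : 𝓞 K) ∈ 𝔭.asIdeal)
          (he : 𝔭.asIdeal.ramificationIdx (𝓞 ℚ) = 1) (hf : 𝔭.asIdeal.inertiaDeg (𝓞 ℚ) = 1),
          IMCLowerWaldspurgerOnTreeAt p κ 𝔭 γ (embAt K p 𝔭 h𝔭 he hf) P)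
    (hU : ∀ (W : WeierstrassCurve ℚ) [W.IsElliptic] [W.IsGloballyMinimal] (p : ℕ) [Fact p.Prime],
      ClassX11b W p → Surj W p → ¬ (Ram W p ∧ ¬ p ∣ W.tamagawaProduct) →
        Typed.MissingUpperBoundAt W p)
    (hC : ∀ (W : WeierstrassCurve ℚ) [W.IsElliptic] [W.IsGloballyMinimal] (p : ℕ) [Fact p.Prime],
      ClassX11b W p → ¬ Surj W p → p ∣ padicValInt p W.minimalDiscriminantInt → ¬ Ram W p →
        Typed.MissingPPartAt W p)
    (W : WeierstrassCurve ℚ) [W.IsElliptic] [W.IsGloballyMinimal] (p : ℕ) [Fact p.Prime]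
    (hX : ClassX11b W p) : BSDp W p := by
  haveI : NeZero (W.conductorNorm ℤ) := ⟨(W.conductorNorm_pos_holds).ne'⟩
  obtain ⟨hr, hp2, hmult, hirr⟩ := id hX
  obtain ⟨K, _, _, Dt, H, ι, P, Wd, _, _, Cd, hK, hodd, hpd, hHN, hP, hc, hμ, hLt, hWd⟩ :=
    exists_oddHeegnerData hnf hHL hMaz integral_neronScaling_of_isGloballyMinimal_holds W p hr hp2
      hmult hirr
  have hPinf : ¬ IsOfFinAddOrder P :=
    not_isOfFinAddOrder_of_heegner_of_analyticRank_eq_one W _ K Dt H ι P (hGZ _ W K) hmod hr hK hHN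
      hLt hP
  exact bsdp_of_classX11b_odd_of_datum W p K Dt H ι P (hGZ _ W K) hKo (hB _ W K) hSk hWu hGZK hmod
    hPT hEP hX hK hodd hpd hHN hP hc hμ hLt Wd Cd hWd
    (fun hs ↦ hA W p _ K Dt H ι P hX hs rfl hK hodd hpd hμ hHN hLt hP hc hPinf)
    (fun hs hloc ↦ hU W p hX hs hloc) (fun hs hdvd hnr ↦ hC W p hX hs hdvd hnr)

end Summit.BirchSwinnertonDyer.Rank1Residual.X11b

end
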